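import Mathlib
import HarnessLib
import HarnessLib.Audit
import Summits.KontsevichZagierPeriods.Statement
import HarnessLib.Audit.Status.Attr

/-!
Route: CobordismMove

DORMANT since 2026-08-26T05:42:57Z (reconciler: no traction for 8.4 d (last activity item-proof-filed at 2026-08-17T19:48:36Z); parked, not closed — `ledger route dormant route-KontsevichZagierPeriods-CobordismMove --off` to reactivate) — unstaffed, not closed; items shared with open routes are served there. `ledger route dormant <id> --off` reactivates.

# Route CobordismMove — cobordism is a move — closed-form Stokes and signed-sheet degree make
Chern–Weil numbers of ℚ-Nash manifolds KZ-accessible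

It suffices to show X := CubeStokes ∧ SignedSheetTransfer ∧ TopologicalMovesKernel (card
cobordism-is-a-move-characteristic-numbers,
with the refuter's sharpening: the auxiliary cobordism is replaced by a ℚ-semialgebraic bounding
chain, reps are PULLBACKS along chart maps).
CubeStokes (ENGINE of the cobordism move): Stokes for a CLOSED d-form with ℚ-semialgebraic
coefficients A_k on the unit (d+1)-cube is a
relation of the fixed calculus — the signed sum of the 2(d+1) face representations lies in
KZ.relations (no primitive of any integrand is
ever taken: the A_k ARE the primitives). SignedSheetTransfer (ENGINE of the degree move): a
finite-sheeted ℚ-semialgebraic map with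
orientation signs ε_k and constant signed sheet count D acts by [σ, Σ ε_k 1_σk (g∘Φ_k)|det Φ_k'|] −
D·[τ, g] ∈ KZ.relations ("∫_M n*vol =
deg(n)·vol"). TopologicalMovesKernel (TARGET, GPC-strength, stated openly): the kernel conjecture
for the calculus enlarged by the
cube-Stokes and signed-sheet relators; modulo the two engines it is
Literature.NumberTheory.Transcendental.KZKernelConjecture. What the
route ADDS is the topological sector these engines open: Gauss–Bonnet by the degree of the Gauss map
(EllipsoidGaussMapCoV = one move;
GenusTwoGaussBonnet = degree −1 with folds), the anchor vol(ℂP²) = π²/2 (CP2Volume), and — filed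
informally after open until the notion
NashChainRep lands — CobordismInvariance (homologous C¹-Nash cycles give KZ-equivalent reps of every
closed polynomial form; with
TorsionFree = CoactionDevissage 3169 rational homology suffices) and SignatureSector (∫_M P_I(R_g) ~
p_I[M]·c_I·π^(2k)-rep for every
compact oriented ℚ-Nash M^(4k), first test K3 ~ 16·ℂP²-bar: p₁ = −48).
Lean: `CubeStokes ∧ SignedSheetTransfer ∧ TopologicalMovesKernel`

## Assembly
Pure algebra, PROVED as an `example` in the planner's Sketch.lean (rc 0): CubeStokes and
SignedSheetTransfer put the two relator families
inside KZ.relations, the four move sets are inside by KZ.*_subset_relations, so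
AddSubgroup.closure_le bounds the enlarged closure by
relations; TopologicalMovesKernel then yields KZKernelConjecture and
Theorems/KernelFormKernelImpliesStatement.lean
(Summit.KontsevichZagierPeriods.KernelForm.kontsevichZagierPeriods_of_kzKernelConjecture) gives the
summit. A prover copies the 12 lines.

Rationale: WHY THIS LINE. Characteristic numbers of compact ℚ-Nash manifolds are instances of Conjecture 1 that
nobody can check by calculus (∫_K3 p₁(R_g) =
−48·(2π)²·c for the Weil restriction of a quartic), yet topology hands over the certificate: the
Levi-Civita connection of an embedded M
is the Gauss-map pullback of the canonical connection, so P_I(R_g) = γ*P_I(Ω_taut) exactly, and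
γ_*[M] − Σ n_J γ_*[ℂP^J-models] bounds a
ℚ-semialgebraic (4k+1)-chain in the Grassmannian iff the Pontryagin numbers agree (Thom1954,
MilnorStasheff1974 §§15–18; ChernSimons1974
for transgression; semialgebraic chains and C¹ triangulations: BCR1998 §§9.2, 11.7,
OhmotoShiota2017; ℚ-models: AkbulutKing1992,
GhiloniSavi2023 Thm 1.7). Stokes on that chain is CubeStokes cube by cube (interior faces cancel in
the free abelian group because ordered
face maps agree exactly), the ℂP^J anchors are torus-action volumes, and any integer multiplicity
from torsion is removed by TorsionFree.
Imported areas: differential topology (cobordism, Chern–Weil/Chern–Simons), real algebraic geometry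
(Nash manifolds, semialgebraic
homology), classical surface theory (Gauss map). No prior route touches curvature integrands:
GaussManinCertificates' KZStokes (3012) is
codimension-0 Stokes with zero boundary values, MultivaluedCoV's SheetTransfer (2877) is the
unsigned co-null case of SignedSheetTransfer;
the negatives index is empty (2026-08-15).

RANKED CRUXES. #0 TopologicalMovesKernel (target) — kernel conjecture of the calculus enlarged by
the two derived moves of this route: every formal ℤ-combination with value 0 lies in the subgroup
generated by moves (1a), (1b), (2), (3), the cube-Stokes relators (signed face sums of closed
semialgebraic coefficient systems on unit cubes) and the signed-sheet relators [σ, Σ ε_k 1_σk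
(g∘Φ_k)|det Φ_k'|] − D·[τ, g]. Honest status: modulo CubeStokes and SignedSheetTransfer it is
EQUIVALENT to KZKernelConjecture (GPC-strength; the strength barriers bite here and only here). (why
it might fail: GPC-strength: equivalent to KZKernelConjecture modulo the two engines; false iff one
equal-valued pair is underivable (Neg's bets: Gauss triplication, regularised MZV relations).)
[KontsevichZagier2001, HuberMullerStach2017, CressonViusos2022]
#2 CubeStokes (crux) — CLOSED-FORM STOKES ON THE UNIT CUBE IS A RELATION (engine of the cobordism
move; card item StokesOnNash at cube level; to be shared with integrate-over-the-cycle's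
ClosedFormStokes). Data: d ≥ 0; coefficients A_0..A_d ℚ-semialgebraic and continuous on the closed
cube [0,1]^(d+1); partials A'_k = ∂_k A_k existing at every point of the open cube, ℚ-semialgebraic
and absolutely integrable there, with Σ_k (−1)^k ∂_k A_k = 0 on the open cube (the form Σ A_k
dx_0..^k..dx_d is closed); face reps rf k s (s = 0,1) on the open unit d-cube with integrand y ↦
A_k(insert s at slot k). Claim: Σ_k Σ_s (−1)^(k+s) [rf k s] ∈ KZ.relations. Plan: for each k one
coordinate-permutation change of variables (linear, |det| = 1) + one newtonLeibnizRel (base = open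
d-cube, a = 0, b = 1, primitive A_k: continuous on closed fibres, derivative A'_k inside) +
integrand additivity to split F(x,1) − F(x,0) into the two faces + null faces by domain additivity;
then Σ_k (−1)^k [cube, A'_k] = [cube, 0] ∈ relations by integrand additivity. [difficulty: L] (why
it might fail: As typed: transporting ContinuousOn/HasDerivAt through the permutation CoV and Lean's
Fin.insertNth/Function.update bookkeeping; a missing toolkit lemma (semialgebraicity of y ↦
A_k(insertNth k s y), of A∘(linear map)) would stall, not falsify; value is 0 by Fubini+FTC.)
[KontsevichZagier2001, HuberMullerStach2017, BasuPollackRoy2006, BCR1998]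
#3 SignedSheetTransfer (crux) — DEGREE IS A MOVE (card item DegreeIsAMove; darg/link-twist-writhe's
(L2)/(D) credited to this card). Data: r, r' : IntegralRep n; sheets σ_k ⊆ r.domain (k < N)
ℚ-semialgebraic with r.domain ∖ ⋃σ_k null; signs ε_k = ±1; maps Φ_k ℚ-semialgebraic on σ_k,
differentiable within σ_k, injective on σ_k, Φ_k(σ_k) ⊆ r'.domain; SIGNED SHEET COUNT Σ_k ε_k 1_(Φ_k
σ_k) = D a.e. on r'.domain; integrand identity r.integrand = Σ_k ε_k 1_σk (r'.integrand∘Φ_k)|det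
Φ_k'| on ⋃σ_k. Claim: [r] − D·[r'] ∈ KZ.relations. Generalises MultivaluedCoV.SheetTransfer (stmt
2877: ε ≡ 1, each image co-null). Plan: peel the N signed summands by integrand additivity (partial
sums are reps), negation is derived ([σ,0] − [σ,f] − [σ,−f] ∈ integrandAddRel), one
changeOfVariablesRel per sheet, then regroup the images on the finitely many Boolean atoms of (Φ_k
σ_k)_k by domain additivity: on each atom of positive measure the signed count is the constant D,
null atoms are relations. [difficulty: L] (why it might fail: Value identity is Fubini-free
bookkeeping (true); the risk is as-typed: Boolean atoms of the images must be ℚ-semialgebraic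
(Tarski–Seidenberg image theorem in the tree is stated over ℝ for IsSemialgebraicMapOn — check it
gives ℚ-coefficients) and partial sums must be IntegralReps.) [KontsevichZagier2001, BCR1998,
book:abate2012-curves-surfaces, HuberMullerStach2017]
#4 GenusTwoGaussBonnet (crux) — GAUSS–BONNET WITH FOLDS for the explicit genus-2 ℚ-sextic M = (z² +
F(x,y) = 0), F = (x²+y²−16)((x−2)²+y²−1)((x+2)²+y²−1) (Ω = (F<0) is the disc of radius 4 minus two
unit discs; M is its smooth double, χ(M) = −2). Upper sheet z = u = √(−F) over Ω; Gauss-curvature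
density K dA = (u_xx u_yy − u_xy²)/(1+u_x²+u_y²)^(3/2) dx dy (written with fderiv; equals an
algebraic function of x, y, u on Ω). Claim: [Ω, K⁺dA-density] + [unit disc D, 1/√(1−u²−v²)] ∈
KZ.relations (values −2π and 2π: half of 2πχ by the symmetry z ↦ −z; hemisphere area). Checked
numerically in the planner folder (num/genus2_check.py: grid 3200² gives −6.2779 vs −2π = −6.2832;
pointwise density cross-checked against the implicit bordered-Hessian formula). Plan: the projected
Gauss map Φ = (n_x, n_y) has |det DΦ| = |K| (as in EllipsoidGaussMapCoV); split Ω into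
ℚ-semialgebraic cells on which K has constant sign and Φ is injective (finite, exists by
semialgebraic local triviality), apply SignedSheetTransfer with ε = sign K towards [D, 1/√(1−|w|²)]
where the signed sheet count is deg = 1 − g = −1 a.e. (so D = −1), i.e. [Ω, K⁺dA] + [D, …] ∈
relations. [deps: SignedSheetTransfer] [difficulty: L] (why it might fail: The injectivity cells of
the Gauss map on (K<0) are not explicit for this sextic (existence only, via Hardt triviality not
yet in the tree); the signed count −1 a.e. must be certified cell by cell; fderiv-junk off Ω is
harmless (EqOn on Ω) but 1/0 conventions at K = 0 curves need care.)
[book:abate2012-curves-surfaces, KontsevichZagier2001, BCR1998]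
#5 EllipsoidGaussMapCoV (crux) — THE GAUSS MAP IS ONE CHANGE OF VARIABLES (degree-1 calibration;
first curvature integrand in the tree). Ellipsoid x²/A + y²/B + z²/C = 1, A, B, C ∈ ℚ_>0; upper
sheet over the open ellipse U = (x²/A + y²/B < 1): K·dA-density = 1/(A·B·z·M^(3/2)) with z = √(C(1 −
x²/A − y²/B)), M = x²/A² + y²/B² + z²/C² (K = 1/(ABC·M²), dA = C√M/z dxdy). Claim: [U, 1/(A B z
M^(3/2))] − [open unit disc, 1/√(1−u²−v²)] ∈ changeOfVariablesRel, witnessed by the projected Gauss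
map Φ(x,y) = ((x/A)/√M, (y/B)/√M): ℚ-semialgebraic, smooth and injective on U (strict convexity),
Φ(U) = open unit disc exactly, and |det DΦ| = K so that f = (1/n_z)∘Φ · |det DΦ| with 1/n_z = C√M/z
= 1/√(1−|Φ|²). Both values 2π (half of 4π). Verified numerically (num/ellipsoid_check.py: ∫_U f = 2π
to 1e−8 for (A,B,C) = (1,2,3), (4,1,1/4), (1,1,1); |det DΦ|/K = 1 to 1e−10 at sample points).
[difficulty: M] (why it might fail: One-move claim needs Φ '' U = open disc EXACTLY and
HasFDerivWithinAt/InjOn on U literally; a boundary point in the image or a branch slip in √M would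
push it to a 3-move chain (restrict + CoV + null set) without changing the mathematics.)
[book:abate2012-curves-surfaces, KontsevichZagier2001, Gauss1812]
#9 CP2Volume (support) — ANCHOR vol(ℂP²) = π²/2 as a chain with KZ-literal (rational) data: 2·[ℝ⁴,
1/(1+|x|²)³] − [ℝ², 1/((1+x₀²)(1+x₁²))] ∈ KZ.relations (ω_FS² on the affine chart is
(2/π²)·dV/(1+|z|²)³; values 2·π²/2 and π²). Plan: polar/torus changes of variables (x₀,x₁,x₂,x₃) ↦
(s = x₀²+x₁², t = x₂²+x₃², two angles) on the complement of a null set, tan-half-angle for the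
angles, Newton–Leibniz in s and t with rational primitives; this is the U(1)²-action instance of
card bending-flows-dh-is-a-move (credited). It is the anchor every SignatureSector chain ends in.
[difficulty: M] [KontsevichZagier2001, MilnorStasheff1974]
#9 TorsionFree (support) — P_KZ = FormalRep/relations is torsion-free: n ≠ 0, n·c ∈ KZ.relations ⇒ c
∈ KZ.relations (shared verbatim with CoactionDevissage stmt-KontsevichZagierPeriods-3169, difficulty
provable-now there: multiply by [0,1], slice into n slabs, translate). Load-bearing here because a
bounding chain in the Grassmannian exists in general only for an integer MULTIPLE of γ₀*[M₀] −
γ₁*[M₁] (2-torsion of Ω^SO and of H_*(BO;ℤ)), so the cobordism chain certifies N·(ρ(M₀) − ρ(M₁)) ∈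
relations and TorsionFree removes N — the calculus has no division rule otherwise. [difficulty:
provable-now] [KontsevichZagier2001, Thom1954, MilnorStasheff1974]
#9 KernelFormGlue (support) — GLUE TO THE RANK-0 TARGET (rev 3, route-choice 2026-08-16, option (a);
gate shape route.target-unreachable): the plain kernel form of Conjecture 1 — every formal
ℤ-combination of integral representations with value 0 lies in KZ.relations, INLINED (never the
Literature constant KZKernelConjecture, which is open and ≡ the summit in tree, so no
open-conjecture constant enters the cone; same idiom as IsogenyCertificates.KernelFormGlue) —
implies TopologicalMovesKernel by monotonicity of AddSubgroup.closure (relations = closure(moves) ≤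
closure(moves ∪ cube-Stokes relators ∪ signed-sheet relators)); conversely CubeStokes →
SignedSheetTransfer → TopologicalMovesKernel → kernel form is the deciding theorem `closes` read in
kernel form. Both directions are examples in the planner's Sketch.lean (rc 0). The item records the
thesis' honesty clause formally — the target is sandwiched between the kernel form and the kernel
form given the two engines, GPC-strength exactly there — and gives the target an item that concludes
it; it is NOT a claim that the kernel form is this route's to prove (a seat on the antecedent is a
seat on the summit). [difficulty: provable-now] [KontsevichZagier2001, HuberMullerStach2017]

TWO-LAYER PLAN. Foreseen glued splits (k ≤ 3, depth 1), filed only when a crux closes or stalls: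
CubeStokes ⇐ CubeStokesLastCoordinate (k = d only:
one newtonLeibnizRel + faces) → CoordinatePermutationCoV (linear CoV transports the hypotheses) →
CubeStokes; GenusTwoGaussBonnet ⇐
GaussMapJacobian (|det DΦ| = |K| on Ω, pointwise) → GaussMapSignedCount (cells + count −1 a.e.) →
GenusTwoGaussBonnet (glue =
SignedSheetTransfer); CobordismInvariance (informal, rank 6 after open) ⇐ PullbackCubeStokes
(CubeStokes for A_k = coefficients of c*ω, c a
C²-Nash cube map, ω a closed polynomial form) → AtlasIndependence (two oriented C¹-Nash fundamental
cycles of M give equivalent reps) →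
CobordismInvariance, once notion NashChainRep lands; SignatureSector (informal, rank 7) ⇐
CobordismInvariance + CPnChernWeilAnchor
(P_I(R_FS) = const·ω^n pointwise on the projector model, reduced to CP2Volume-type reps) with
TorsionFree.

KILL CRITERIA. Refuting CubeStokes or SignedSheetTransfer (values certified equal, so a refutation
exhibits a defect of the FIXED calculus: a
semialgebraic Stokes/degree instance outside KZ.relations) closes the route refuted:<Decl> AND is
reported to the operator and to route Neg
(NegObstructionShape) — it would refute the summit. Refuting EllipsoidGaussMapCoV as a ONE-move
claim only downgrades it to a short chain
(restate); refuting GenusTwoGaussBonnet or CP2Volume (value identities certified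
numerically/classically) refutes the summit. If the
informal CobordismInvariance is shown to need more than TorsionFree + CubeStokes + AtlasIndependence
(e.g. bounding chains cannot be taken
C¹ up to the boundary over ℚ), pivot to the Nash-cobordism-W form of the card (relative Nash–Tognoli
over ℚ, Savi 2026) as a restate.
KZKernelConjecture proved elsewhere moots everything but the two engines and the calibrations.

NOT DECOMPOSED YET. The manifold/chain level (NashChainRep: the formal rep of a polynomial d-form
along a C¹-Nash singular or cubical chain, its boundary, and
AtlasIndependence) — definition request, informal cruxes CobordismInvariance / SignatureSector filed
right after open; the facts "C¹
semialgebraic triangulation over ℚ" (OhmotoShiota2017 over ℝ; ℚ-definability of the triangulation to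
be checked), "semialgebraic chains
compute H_*(V;ℚ)" (BCR1998 §11.7), "H_4k(Gr;ℚ) is dual to Pontryagin polynomials / rational
cobordism = Pontryagin numbers" (Thom1954,
MilnorStasheff1974) as cite requests; the pointwise identity "Levi-Civita = Gauss-map pullback of
the canonical connection" (elementary,
prover lemma); PullbackCubeStokes (d commutes with pullback in fderiv language);
Euler-class/unstable-Grassmannian bookkeeping (stabilise by
TM ⊕ ℝ); DegreeIsAMove for the Gauss map of a general ℚ-surface (GenusTwo is the typed
representative); linking numbers (owned by card
link-twist-writhe-configuration-integrals, which uses SignedSheetTransfer).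

CHEAPEST FALSIFIER. (i) d = 0 case of CubeStokes ([0,1], faces are IntegralRep 0 constants: F(1) −
F(0) = ∫F′ is literally one newtonLeibnizRel — if the typed
hypotheses do not yield it, the signature is wrong); (ii) the Jacobian identity |det DΦ| = K for the
ellipsoid and the value 2π (DONE:
num/ellipsoid_check.py, 1e−10 and 1e−8); (iii) the genus-2 value −2π (DONE: −6.2779 at grid 3200²,
converging; pointwise density checked two
ways); (iv) N = 1, ε = 1 instance of SignedSheetTransfer is exactly rule (2) plus null sets — a
prover warm-up; (v) lookup: is closed-form
Stokes on semialgebraic cubes inside the KZ rules already formalised or printed as a theorem?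
(searched lit --hybrid / tree: no; KZCalculus.lean
docstring asserts it without proof; GaussManin 3012 and this item are the first typed forms).

NUMBERS. χ(genus 2) = −2, half-integral −2π = −6.28319 (grid 400/800/1600/3200:
−6.2330/−6.2756/−6.2746/−6.2779); ellipsoid half-integral 2π
(rel. err 5e−8, 3e−9, 3e−8 for three (A,B,C)); vol(ℂP²) = π²/2 = ∫_ℝ⁴(1+|x|²)^−3 (= 2π²·1/4); K3: p₁
= −48, σ = −16, χ = 24; ℂP²: p₁ = 3,
χ = 3; Ω^SO_4 = ℤ (signature), torsion of Ω^SO_* and H_*(BO;ℤ) has exponent 2 (handled by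
TorsionFree with n = 2). Items at open: 8 (target,
assembly, 4 cruxes, 2 support); 2 informal cruxes + 1 definition + 3 cite requests filed right
after. Rev 3 (route-choice 2026-08-16): +1 glue support item KernelFormGlue (kernel form →
TopologicalMovesKernel), 11 items (target, assembly, 4 typed cruxes + 1 informal auto-crux, 3 typed
supports + 1 informal).

DEFINITION REQUESTS. notion NashChainRep (topic Literature/NumberTheory/Transcendental, next to
KZCalculus/KZProduct): for a finite ℤ-combination of C¹
ℚ-semialgebraic (Nash on the interior) maps c_j : [0,1]^d → ℝ^N (or ordered simplices) and a d-form
ω on ℝ^N with ℚ-polynomial coefficients,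
the formal rep Σ n_j [open cube, x ↦ ω(c_j x)(∂_1 c_j x, …, ∂_d c_j x)] : KZ.FormalRep, its boundary
chain, and the lemma that boundaries of
chains with exactly matching face maps cancel in FormalRep. Cite requests (kind cite, family
periods): C¹-triangulation of compact
semialgebraic sets (OhmotoShiota2017 Thm 1.1; ℚ-definable version wanted), semialgebraic homology =
singular homology with ℚ-coefficients
and bounding chains for null-homologous semialgebraic cycles (BCR1998 §11.7), rational (co)homology
of Grassmannians/BO = Pontryagin
polynomials and Thom's rational cobordism theorem (Thom1954, MilnorStasheff1974 §§15–18).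

Novelty: Searches (2026-08-15): card audit (refuter-novelty-10: zbMATH/crossref; READ GhiloniSavi2023 =
arXiv:2302.04142 p.1, Savi Adv. Math. 2026
doi:10.1016/j.aim.2025.110757 paywalled acq-01684, Ballico–Tognoli doi:10.1007/bf00147546); this
session: `lit search --hybrid "Gauss-Bonnet
Gauss map degree change of variables curvature integral Kontsevich Zagier period rules"` (12
textbook hits: book:abate2012-curves-surfaces,
book:lee2018-introduction-riemannian-manifolds, book:chern1975-differential-geometry … — classical
Gauss map/degree, no rules reading),
`lit search --hybrid "Stokes formula subanalytic semialgebraic sets integration of differential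
forms stratified"` (10 hits, generic
manifolds texts; no semialgebraic-chain Stokes inside KZ), `lit read arxiv:2302.04142 --grep
bordism` (Thm 1.7 p.5 read: ℚ-nonsingular
ℚ-algebraic models in ℝ^(2d+1); §2.4 projectively ℚ-algebraic unoriented bordism), crossref
"C1-triangulations of semialgebraic sets"
(OhmotoShiota2017 doi:10.1112/topo.12024), `lit frontier KontsevichZagierPeriods --since 2020` (30
rows: MZV/odd-zeta/motivic coaction; none on
Chern–Weil or cobordism), `lit bridges --cross any` (30 rows, none relevant), `ledger negatives`
(empty), tree: `lean search` KZStokes 3012 /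
SheetTransfer 2877 / TorsionFree 3169 (nearest typed neighbours). Remote cascades (OpenAlex/arXiv)
returned HTTP 429 and galaxy --star all
queued > 90 s this session (logged in NOTES.md); claim limited to held texts + card corpus +
crossref.
Nearest prior a  [refs: 10.1016/j.aim.2025.110757, 10.1007/bf00147546, 10.1112/topo.12024, 10.1007/978-1-4613-9739-7, 10.2307/1971013, 2302.04142, doi:10.1016/j.aim.2025.110757, doi:10.1007/bf00147546, book:abate2012-curves-surfaces, book:lee2018-introduction-riemannian-manifolds, book:chern1975-differential-geometry, arxiv:2302.04142, doi:10.1112/topo.12024, doi:10.1007/978-1-4613-9739-7, doi:10.2307/1971013, GhiloniSav]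

Barriers (technique_class: algebraic-cobordism, chern-weil-stokes, gauss-map-degree): - technique_class: algebraic-cobordism, chern-weil-stokes, gauss-map-degree
- Literature.Barriers.KontsevichZagierPeriods.noSemialgebraicPrimitive_inv_sub_two: evaded by
construction — CubeStokes integrates only EXACT forms whose primitives are the given semialgebraic
coefficients A_k (Chern–Weil/Chern–Simons coefficients, pullbacks of polynomial forms);
SignedSheetTransfer and the calibrations use rule (2) and additivity only; no variable of an
arbitrary integrand is integrated out.
- Literature.Barriers.KontsevichZagierPeriods.cressonViuSos_prop_3_2: not engaged — every item
dissects (cube faces, sheets, Boolean atoms, null sets); the one global map claimed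
(EllipsoidGaussMapCoV) is between open 2-cells (open ellipse → open disc), where the Hauptvermutung
hypothesis (compact polyhedra, dim ≥ 5) is vacuous.
- Literature.Barriers.KontsevichZagierPeriods.kzConjecture_implies_oddZetaAlgIndep: bites the target
TopologicalMovesKernel only (it is KZKernelConjecture modulo the engines, said openly); every
crux/support item is an unconditional derived-rule or accessibility statement with values in ℚ·π^k
certified equal.
- Literature.Barriers.KontsevichZagierPeriods.kzConjecture_implies_twoPiI_log_algIndep: same —
confined to the target; the sector's values are ℚ·π^(2k) (Euler/Pontryagin numbers), no logarithms.
- Literature.Barriers.KontsevichZagierPeriods.kzConjecture_implies_ellipticPeriods_algIndep: same —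
no elliptic periods occur.
- Literature.Barriers.KontsevichZagierPeriods.n

Novelty grade: new-combination — Route-review refuter grade (searchd down; documented search: lit galaxy bm25 'KZ period conjecture … characteristic numbers … cobordism / degree of the Gauss map … Nash' (15 hits, all generic: Müller-Stach 'What is a period?', Chern–Weil surveys — none reads Gauss–Bonnet/Pontryagin numbers as period (refuter refuter-rreview-route-CriticalPhenomena--48330c20-0, 2026-08-15T14:13:11Z; prior: KontsevichZagier2001 §1.2 (rule 3 'replace Newton–Leibniz by Stokes' — Stokes on algebraic chains is meant to be inside the rules), HuberMullerStach2017 Ch. 12–13 (semialgebraic/Nash simplices, naive periods, Stokes), Thom1954 + MilnorStasheff1974 §§15–18 (rational oriented cobordism = Pontryagin numbers), ChernSimons1974 (transgression; Levi-Civita = Gauss-map pullback of the tautological connect)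

History (route lifecycle, newest last):
- 2026-08-16T02:18:03Z · AUTO-CRUX: 2 conjecture-grade item(s) promoted to crux (TopologicalMovesKernel, SignatureSector) — refuter vetting / tiering apply (operator:999:1362873)
- 2026-08-16T04:07:52Z · AUTO-CRUX (backfill): TopologicalMovesKernel — hypotheses of the deciding theorem that nothing in the route derives are cruxes (operator:999:1085951)
- 2026-08-26T05:42:57Z · DORMANT — reconciler: no traction for 8.4 d (last activity item-proof-filed at 2026-08-17T19:48:36Z); parked, not closed — `ledger route dormant route-KontsevichZagierPer (operator:999:766811)

sub-problem: KontsevichZagierPeriods · status: dormant · opened planner-plancard-KontsevichZagierPeriods-Kont-fd0d5c8d-0 2026-08-15T11:41:36Z · rev 3 · ledger route-KontsevichZagierPeriods-CobordismMove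
GENERATED by the gate from the ledger (D-0016/17). Provers cite these decls: `theorem foo : Summit.KontsevichZagierPeriods.KontsevichZagierPeriods.Theses.CobordismMove.<Decl> := …` in Summits/KontsevichZagierPeriods/KontsevichZagierPeriods/Theorems/<Name>.lean.
-/

namespace Summit.KontsevichZagierPeriods.KontsevichZagierPeriods.Theses.CobordismMove

open scoped BigOperators Topology Manifold Classical MeasureTheory ProbabilityTheory Matrix InnerProductSpace ComplexConjugate ContinuousMap
open Filter Set Function TopologicalSpace MeasureTheory

attribute [summit_statement] _root_.KontsevichZagierPeriods

open Literature Periods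

/-- item stmt-KontsevichZagierPeriods-5565 · crux (kind.auto-crux: conjecture-grade) · rank 0 · open · by planner
why it might fail: GPC-strength: equivalent to KZKernelConjecture modulo the two engines; false iff one equal-valued pair is underivable (Neg's bets: Gauss triplication, regularised MZV relations).
sources: KontsevichZagier2001, HuberMullerStach2017, CressonViusos2022
[target] kernel conjecture of the calculus enlarged by the two derived moves of this route: every
formal ℤ-combination with value 0 lies in the subgroup generated by moves (1a), (1b), (2), (3), the
cube-Stokes relators (signed face sums of closed semialgebraic coefficient systems on unit cubes)
and the signed-sheet relators [σ, Σ ε_k 1_σk (g∘Φ_k)|det Φ_k'|] − D·[τ, g]. Honest status: modulo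
CubeStokes and SignedSheetTransfer it is EQUIVALENT to KZKernelConjecture (GPC-strength; the
strength barriers bite here and only here). -/
@[route_item "route-KontsevichZagierPeriods-CobordismMove", crux]
def TopologicalMovesKernel : Prop :=
  ∀ c : Literature.NumberTheory.Transcendental.KZ.FormalRep, Literature.NumberTheory.Transcendental.KZ.eval c = 0 → c ∈ AddSubgroup.closure (Literature.NumberTheory.Transcendental.KZ.domainAddRel ∪ Literature.NumberTheory.Transcendental.KZ.integrandAddRel ∪ Literature.NumberTheory.Transcendental.KZ.changeOfVariablesRel ∪ Literature.NumberTheory.Transcendental.KZ.newtonLeibnizRel ∪ {e | ∃ (d : ℕ) (A A' : Fin (d + 1) → (Fin (d + 1) → ℝ) → ℝ) (rf : Fin (d + 1) → Fin 2 → Literature.NumberTheory.Transcendental.KZ.IntegralRep d), (∀ k, Literature.NumberTheory.Transcendental.IsSemialgebraicFunOn ℚ (Set.Icc (0 : Fin (d + 1) → ℝ) 1) (A k)) ∧ (∀ k, Literature.NumberTheory.Transcendental.IsSemialgebraicFunOn ℚ {x : Fin (d + 1) → ℝ | ∀ i, x i ∈ Set.Ioo (0 : ℝ) 1} (A' k))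 ∧ (∀ k, ContinuousOn (A k) (Set.Icc (0 : Fin (d + 1) → ℝ) 1)) ∧ (∀ k, ∀ x ∈ {x : Fin (d + 1) → ℝ | ∀ i, x i ∈ Set.Ioo (0 : ℝ) 1}, HasDerivAt (fun t : ℝ => A k (Function.update x k t)) (A' k x) (x k)) ∧ (∀ k, MeasureTheory.IntegrableOn (A' k) {x : Fin (d + 1) → ℝ | ∀ i, x i ∈ Set.Ioo (0 : ℝ) 1}) ∧ (∀ x ∈ {x : Fin (d + 1) → ℝ | ∀ i, x i ∈ Set.Ioo (0 : ℝ) 1}, ∑ k : Fin (d + 1), (-1 : ℝ) ^ (k : ℕ) * A' k x = 0) ∧ (∀ k s, (rf k s).domain = {y : Fin d → ℝ | ∀ i, y i ∈ Set.Ioo (0 : ℝ) 1}) ∧ (∀ k s, Set.EqOn (rf k s).integrand (fun y => A k (Fin.insertNth k ((s : ℕ) : ℝ) y)) (rf k s).domain) ∧ e = ∑ k : Fin (d + 1), ∑ s : Fin 2, ((-1 : ℤ) ^ ((k : ℕ) + (s : ℕ))) • Literature.NumberTheory.Transcendental.KZ.of (rf k s)} ∪ {e | ∃ (n N : ℕ)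 (D : ℤ) (r r' : Literature.NumberTheory.Transcendental.KZ.IntegralRep n) (ε : Fin N → ℤ) (σ : Fin N → Set (Fin n → ℝ)) (Φ : Fin N → (Fin n → ℝ) → (Fin n → ℝ)) (Φ' : Fin N → (Fin n → ℝ) → ((Fin n → ℝ) →L[ℝ] (Fin n → ℝ))), (∀ k, ε k = 1 ∨ ε k = -1) ∧ (∀ k, Literature.ModelTheory.ExponentialFields.IsSemialgebraic ℚ (σ k)) ∧ (∀ k, σ k ⊆ r.domain) ∧ MeasureTheory.volume (r.domain \ ⋃ k, σ k) = 0 ∧ (∀ k, Literature.NumberTheory.Transcendental.IsSemialgebraicMapOn ℚ (σ k) (Φ k)) ∧ (∀ k, ∀ x ∈ σ k, HasFDerivWithinAt (Φ k) (Φ' k x) (σ k) x) ∧ (∀ k, Set.InjOn (Φ k) (σ k)) ∧ (∀ k, Φ k '' σ k ⊆ r'.domain) ∧ (∀ᵐ y ∂(MeasureTheory.volume.restrict r'.domain), (∑ k : Fin N, (ε k : ℝ) * (Φ k '' σ k).indicator (fun _ => (1 : ℝ)) y) = (D : ℝ)) ∧ (∀ x ∈ ⋃ k, σ k, r.integrand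 x = ∑ k : Fin N, (ε k : ℝ) * (σ k).indicator (fun y => r'.integrand (Φ k y) * |(Φ' k y).det|) x) ∧ e = Literature.NumberTheory.Transcendental.KZ.of r - D • Literature.NumberTheory.Transcendental.KZ.of r'})

/-- item stmt-KontsevichZagierPeriods-17771 · crux · rank 2 · closed · proved by Summit.KontsevichZagierPeriods.CobordismMove.CubeLastNewtonLeibniz.cubeLastNewtonLeibniz_proof @ 39c94118cacb (prover) · by planner
[crux] NEWTON–LEIBNIZ ALONG THE LAST COORDINATE OF THE OPEN UNIT CUBE, BULK TERM INCLUDED (piece P1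
of the typed decomposition of CubeStokes; carries its analytic content). Data: d ≥ 0; ONE
coefficient A, ℚ-semialgebraic and continuous on the closed cube [0,1]^(d+1); a function A' with
HasDerivAt (s ↦ A (Fin.snoc y s)) (A' (Fin.snoc y t)) t for every y in the open d-cube and t ∈
(0,1); a bulk rep R = [(0,1)^(d+1), A'] (any IntegralRep with that domain and integrand =ᵉ A'); face
reps r₀, r₁ on the open d-cube with integrands y ↦ A (Fin.snoc y 0), y ↦ A (Fin.snoc y 1). Claim: of
R − of r₁ + of r₀ ∈ KZ.relations (value: ∫_{(0,1)^{d+1}} ∂_last A = ∫ A(·,1) − ∫ A(·,0), Fubini +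
FTC). Plan (derivation in the fixed calculus, all pieces in the tree): (i) pass from the open cube
to the closed-fibre band B = {z | init z ∈ (0,1)^d ∧ 0 ≤ z last ≤ 1} by domain additivity (rule 1a)
with the null faces {z last ∈ {0,1}} (of_mem_relations_of_volume_eq_zero), extending the integrand
by 0 off the open cube (IsSemialgebraicFunOn.union); (ii) ONE newtonLeibnizRel instance: base
(0,1)^d, a = 0, b = 1, primitive F = A (semialgebraic on B ⊆ Icc by mono; continuous on closed
fibres; derivative = integrand -/
@[route_item "route-KontsevichZagierPeriods-CobordismMove", crux]
def CubeLastNewtonLeibniz : Prop :=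
  ∀ (d : ℕ) (A A' : (Fin (d + 1) → ℝ) → ℝ) (R : Literature.NumberTheory.Transcendental.KZ.IntegralRep (d + 1)) (r₀ r₁ : Literature.NumberTheory.Transcendental.KZ.IntegralRep d), Literature.NumberTheory.Transcendental.IsSemialgebraicFunOn ℚ (Set.Icc (0 : Fin (d + 1) → ℝ) 1) A → ContinuousOn A (Set.Icc (0 : Fin (d + 1) → ℝ) 1) → (∀ y ∈ {y : Fin d → ℝ | ∀ i, y i ∈ Set.Ioo (0 : ℝ) 1}, ∀ t ∈ Set.Ioo (0 : ℝ) 1, HasDerivAt (fun s : ℝ => A (Fin.snoc y s)) (A' (Fin.snoc y t)) t) → R.domain = {x : Fin (d + 1) → ℝ | ∀ i, x i ∈ Set.Ioo (0 : ℝ) 1} → Set.EqOn R.integrand A' R.domain → r₀.domain = {y : Fin d → ℝ | ∀ i, y i ∈ Set.Ioo (0 : ℝ) 1} → r₁.domain = {y : Fin d → ℝ | ∀ i, y i ∈ Set.Ioo (0 : ℝ) 1} → Set.EqOn r₀.integrand (fun y => A (Fin.snoc y 0)) r₀.domain → Set.EqOn r₁.integrand (fun y => A (Fin.snoc y 1))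 r₁.domain → Literature.NumberTheory.Transcendental.KZ.of R - Literature.NumberTheory.Transcendental.KZ.of r₁ + Literature.NumberTheory.Transcendental.KZ.of r₀ ∈ Literature.NumberTheory.Transcendental.KZ.relations

-- `CubeLastNewtonLeibniz` holds: proved by `Summit.KontsevichZagierPeriods.CobordismMove.CubeLastNewtonLeibniz.cubeLastNewtonLeibniz_proof` @ 39c94118cacb (its module imports this route file, so no `_holds` link can be stated here).

/-- item stmt-KontsevichZagierPeriods-5566 · crux · rank 2 · closed · proved by Summit.KontsevichZagierPeriods.CobordismMove.cubeStokes_proof @ 3b2a680498c2 (prover) · by planner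
why it might fail: As typed: transporting ContinuousOn/HasDerivAt through the permutation CoV and Lean's Fin.insertNth/Function.update bookkeeping; a missing toolkit lemma (semialgebraicity of y ↦ A_k(insertNth k s y), of A∘(linear map)) would stall, not falsify; value is 0 by Fubini+FTC.
sources: KontsevichZagier2001, HuberMullerStach2017, BasuPollackRoy2006, BCR1998
[crux] CLOSED-FORM STOKES ON THE UNIT CUBE IS A RELATION (engine of the cobordism move; card item
StokesOnNash at cube level; to be shared with integrate-over-the-cycle's ClosedFormStokes). Data: d
≥ 0; coefficients A_0..A_d ℚ-semialgebraic and continuous on the closed cube [0,1]^(d+1); partials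
A'_k = ∂_k A_k existing at every point of the open cube, ℚ-semialgebraic and absolutely integrable
there, with Σ_k (−1)^k ∂_k A_k = 0 on the open cube (the form Σ A_k dx_0..^k..dx_d is closed); face
reps rf k s (s = 0,1) on the open unit d-cube with integrand y ↦ A_k(insert s at slot k). Claim: Σ_k
Σ_s (−1)^(k+s) [rf k s] ∈ KZ.relations. Plan: for each k one coordinate-permutation change of
variables (linear, |det| = 1) + one newtonLeibnizRel (base = open d-cube, a = 0, b = 1, primitive
A_k: continuous on closed fibres, derivative A'_k inside) + integrand additivity to split F(x,1) −
F(x,0) into the two faces + null faces by domain additivity; then Σ_k (−1)^k [cube, A'_k] = [cube,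
0] ∈ relations by integrand additivity. [difficulty: L] -/
@[route_item "route-KontsevichZagierPeriods-CobordismMove", crux]
def CubeStokes : Prop :=
  ∀ (d : ℕ) (A A' : Fin (d + 1) → (Fin (d + 1) → ℝ) → ℝ) (rf : Fin (d + 1) → Fin 2 → Literature.NumberTheory.Transcendental.KZ.IntegralRep d), (∀ k, Literature.NumberTheory.Transcendental.IsSemialgebraicFunOn ℚ (Set.Icc (0 : Fin (d + 1) → ℝ) 1) (A k)) → (∀ k, Literature.NumberTheory.Transcendental.IsSemialgebraicFunOn ℚ {x : Fin (d + 1) → ℝ | ∀ i, x i ∈ Set.Ioo (0 : ℝ) 1} (A' k)) → (∀ k, ContinuousOn (A k) (Set.Icc (0 : Fin (d + 1) → ℝ) 1)) → (∀ k, ∀ x ∈ {x : Fin (d + 1) → ℝ | ∀ i, x i ∈ Set.Ioo (0 : ℝ) 1}, HasDerivAt (fun t : ℝ => A k (Function.update x k t)) (A' k x) (x k)) → (∀ k, MeasureTheory.IntegrableOn (A' k) {x : Fin (d + 1) → ℝ | ∀ i, x i ∈ Set.Ioo (0 : ℝ) 1}) → (∀ x ∈ {x : Fin (d + 1) → ℝ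 | ∀ i, x i ∈ Set.Ioo (0 : ℝ) 1}, ∑ k : Fin (d + 1), (-1 : ℝ) ^ (k : ℕ) * A' k x = 0) → (∀ k s, (rf k s).domain = {y : Fin d → ℝ | ∀ i, y i ∈ Set.Ioo (0 : ℝ) 1}) → (∀ k s, Set.EqOn (rf k s).integrand (fun y => A k (Fin.insertNth k ((s : ℕ) : ℝ) y)) (rf k s).domain) → (∑ k : Fin (d + 1), ∑ s : Fin 2, ((-1 : ℤ) ^ ((k : ℕ) + (s : ℕ))) • Literature.NumberTheory.Transcendental.KZ.of (rf k s)) ∈ Literature.NumberTheory.Transcendental.KZ.relations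

-- `CubeStokes` holds: proved by `Summit.KontsevichZagierPeriods.CobordismMove.cubeStokes_proof` @ 3b2a680498c2 (its module imports this route file, so no `_holds` link can be stated here).

/-- item stmt-KontsevichZagierPeriods-5567 · crux · rank 3 · closed · proved by Summit.KontsevichZagierPeriods.CobordismMove.SignedSheetTransferSplit.signedSheetTransfer_proof @ f274459725d0 (planner) · by planner
why it might fail: Value identity is Fubini-free bookkeeping (true); the risk is as-typed: Boolean atoms of the images must be ℚ-semialgebraic (Tarski–Seidenberg image theorem in the tree is stated over ℝ for IsSemialgebraicMapOn — check it gives ℚ-coefficients) and partial sums must be IntegralReps.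
sources: KontsevichZagier2001, BCR1998, book:abate2012-curves-surfaces, HuberMullerStach2017
[crux] DEGREE IS A MOVE (card item DegreeIsAMove; darg/link-twist-writhe's (L2)/(D) credited to this
card). Data: r, r' : IntegralRep n; sheets σ_k ⊆ r.domain (k < N) ℚ-semialgebraic with r.domain ∖
⋃σ_k null; signs ε_k = ±1; maps Φ_k ℚ-semialgebraic on σ_k, differentiable within σ_k, injective on
σ_k, Φ_k(σ_k) ⊆ r'.domain; SIGNED SHEET COUNT Σ_k ε_k 1_(Φ_k σ_k) = D a.e. on r'.domain; integrand
identity r.integrand = Σ_k ε_k 1_σk (r'.integrand∘Φ_k)|det Φ_k'| on ⋃σ_k. Claim: [r] − D·[r'] ∈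
KZ.relations. Generalises MultivaluedCoV.SheetTransfer (stmt 2877: ε ≡ 1, each image co-null). Plan:
peel the N signed summands by integrand additivity (partial sums are reps), negation is derived
([σ,0] − [σ,f] − [σ,−f] ∈ integrandAddRel), one changeOfVariablesRel per sheet, then regroup the
images on the finitely many Boolean atoms of (Φ_k σ_k)_k by domain additivity: on each atom of
positive measure the signed count is the constant D, null atoms are relations. [difficulty: L] -/
@[route_item "route-KontsevichZagierPeriods-CobordismMove", crux]
def SignedSheetTransfer : Prop :=
  ∀ (n N : ℕ) (D : ℤ) (r r' : Literature.NumberTheory.Transcendental.KZ.IntegralRep n) (ε : Fin N → ℤ) (σ : Fin N → Set (Fin n → ℝ)) (Φ : Fin N → (Fin n → ℝ) → (Fin n → ℝ)) (Φ' : Fin N → (Fin n → ℝ) → ((Fin n → ℝ) →L[ℝ] (Fin n → ℝ))), (∀ k, ε k = 1 ∨ ε k = -1) → (∀ k, Literature.ModelTheory.ExponentialFields.IsSemialgebraic ℚ (σ k)) → (∀ k, σ k ⊆ r.domain) → MeasureTheory.volume (r.domain \ ⋃ k, σ k) = 0 → (∀ k, Literature.NumberTheory.Transcendental.IsSemialgebraicMapOn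 ℚ (σ k) (Φ k)) → (∀ k, ∀ x ∈ σ k, HasFDerivWithinAt (Φ k) (Φ' k x) (σ k) x) → (∀ k, Set.InjOn (Φ k) (σ k)) → (∀ k, Φ k '' σ k ⊆ r'.domain) → (∀ᵐ y ∂(MeasureTheory.volume.restrict r'.domain), (∑ k : Fin N, (ε k : ℝ) * (Φ k '' σ k).indicator (fun _ => (1 : ℝ)) y) = (D : ℝ)) → (∀ x ∈ ⋃ k, σ k, r.integrand x = ∑ k : Fin N, (ε k : ℝ) * (σ k).indicator (fun y => r'.integrand (Φ k y) * |(Φ' k y).det|) x) → Literature.NumberTheory.Transcendental.KZ.of r - D • Literature.NumberTheory.Transcendental.KZ.of r' ∈ Literature.NumberTheory.Transcendental.KZ.relations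

-- `SignedSheetTransfer` holds: proved by `Summit.KontsevichZagierPeriods.CobordismMove.SignedSheetTransferSplit.signedSheetTransfer_proof` @ f274459725d0 (its module imports this route file, so no `_holds` link can be stated here).

/-- item stmt-KontsevichZagierPeriods-5568 · crux · rank 4 · open · by planner
why it might fail: The injectivity cells of the Gauss map on (K<0) are not explicit for this sextic (existence only, via Hardt triviality not yet in the tree); the signed count −1 a.e. must be certified cell by cell; fderiv-junk off Ω is harmless (EqOn on Ω) but 1/0 conventions at K = 0 curves need care.
sources: book:abate2012-curves-surfaces, KontsevichZagier2001, BCR1998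
[crux] GAUSS–BONNET WITH FOLDS for the explicit genus-2 ℚ-sextic M = (z² + F(x,y) = 0), F =
(x²+y²−16)((x−2)²+y²−1)((x+2)²+y²−1) (Ω = (F<0) is the disc of radius 4 minus two unit discs; M is
its smooth double, χ(M) = −2). Upper sheet z = u = √(−F) over Ω; Gauss-curvature density K dA =
(u_xx u_yy − u_xy²)/(1+u_x²+u_y²)^(3/2) dx dy (written with fderiv; equals an algebraic function of
x, y, u on Ω). Claim: [Ω, K⁺dA-density] + [unit disc D, 1/√(1−u²−v²)] ∈ KZ.relations (values −2π and
2π: half of 2πχ by the symmetry z ↦ −z; hemisphere area). Checked numerically in the planner folder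
(num/genus2_check.py: grid 3200² gives −6.2779 vs −2π = −6.2832; pointwise density cross-checked
against the implicit bordered-Hessian formula). Plan: the projected Gauss map Φ = (n_x, n_y) has
|det DΦ| = |K| (as in EllipsoidGaussMapCoV); split Ω into ℚ-semialgebraic cells on which K has
constant sign and Φ is injective (finite, exists by semialgebraic local triviality), apply
SignedSheetTransfer with ε = sign K towards [D, 1/√(1−|w|²)] where the signed sheet count is deg = 1
− g = −1 a.e. (so D = −1), i.e. [Ω, K⁺dA] + [D, …] ∈ relations. [deps: SignedSheetTransfer]
[difficulty: L] -/
@[route_item "route-KontsevichZagierPeriods-CobordismMove"]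
def GenusTwoGaussBonnet : Prop :=
  ∀ (F u : (Fin 2 → ℝ) → ℝ), (∀ p, F p = ((p 0) ^ 2 + (p 1) ^ 2 - 16) * (((p 0) - 2) ^ 2 + (p 1) ^ 2 - 1) * (((p 0) + 2) ^ 2 + (p 1) ^ 2 - 1)) → (∀ p, u p = Real.sqrt (- F p)) → ∀ (r r' : Literature.NumberTheory.Transcendental.KZ.IntegralRep 2), r.domain = {p | F p < 0} → Set.EqOn r.integrand (fun p => (fderiv ℝ (fun q => fderiv ℝ u q (Pi.single 0 1)) p (Pi.single 0 1) * fderiv ℝ (fun q => fderiv ℝ u q (Pi.single 1 1)) p (Pi.single 1 1) - (fderiv ℝ (fun q => fderiv ℝ u q (Pi.single 0 1)) p (Pi.single 1 1)) ^ 2) / Real.sqrt (1 + (fderiv ℝ u p (Pi.single 0 1)) ^ 2 + (fderiv ℝ u p (Pi.single 1 1)) ^ 2) ^ 3) r.domain → r'.domain = {w | (w 0) ^ 2 + (w 1) ^ 2 < 1} → Set.EqOn r'.integrand (fun w => 1 / Real.sqrt (1 - (w 0) ^ 2 - (w 1) ^ 2)) r'.domain → Literature.NumberTheory.Transcendental.KZ.of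 r + Literature.NumberTheory.Transcendental.KZ.of r' ∈ Literature.NumberTheory.Transcendental.KZ.relations

/-- item stmt-KontsevichZagierPeriods-5569 · crux · rank 5 · closed · proved by Summit.KontsevichZagierPeriods.CobordismMove.ellipsoidGaussMapCoV_proof @ 02bcf0b9593c (prover) · by planner
why it might fail: One-move claim needs Φ '' U = open disc EXACTLY and HasFDerivWithinAt/InjOn on U literally; a boundary point in the image or a branch slip in √M would push it to a 3-move chain (restrict + CoV + null set) without changing the mathematics.
sources: book:abate2012-curves-surfaces, KontsevichZagier2001, Gauss1812
[crux] THE GAUSS MAP IS ONE CHANGE OF VARIABLES (degree-1 calibration; first curvature integrand in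
the tree). Ellipsoid x²/A + y²/B + z²/C = 1, A, B, C ∈ ℚ_>0; upper sheet over the open ellipse U =
(x²/A + y²/B < 1): K·dA-density = 1/(A·B·z·M^(3/2)) with z = √(C(1 − x²/A − y²/B)), M = x²/A² +
y²/B² + z²/C² (K = 1/(ABC·M²), dA = C√M/z dxdy). Claim: [U, 1/(A B z M^(3/2))] − [open unit disc,
1/√(1−u²−v²)] ∈ changeOfVariablesRel, witnessed by the projected Gauss map Φ(x,y) = ((x/A)/√M,
(y/B)/√M): ℚ-semialgebraic, smooth and injective on U (strict convexity), Φ(U) = open unit disc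
exactly, and |det DΦ| = K so that f = (1/n_z)∘Φ · |det DΦ| with 1/n_z = C√M/z = 1/√(1−|Φ|²). Both
values 2π (half of 4π). Verified numerically (num/ellipsoid_check.py: ∫_U f = 2π to 1e−8 for (A,B,C)
= (1,2,3), (4,1,1/4), (1,1,1); |det DΦ|/K = 1 to 1e−10 at sample points). [difficulty: M] -/
@[route_item "route-KontsevichZagierPeriods-CobordismMove"]
def EllipsoidGaussMapCoV : Prop :=
  ∀ (A B C : ℚ), 0 < A → 0 < B → 0 < C → ∀ (r r' : Literature.NumberTheory.Transcendental.KZ.IntegralRep 2), r.domain = {p | (p 0) ^ 2 / (A : ℝ) + (p 1) ^ 2 / (B : ℝ) < 1} → Set.EqOn r.integrand (fun p => 1 / ((A : ℝ) * (B : ℝ) * Real.sqrt ((C : ℝ) * (1 - (p 0) ^ 2 / (A : ℝ) - (p 1) ^ 2 / (B : ℝ))) * Real.sqrt ((p 0) ^ 2 / (A : ℝ) ^ 2 + (p 1) ^ 2 / (B : ℝ) ^ 2 + (1 - (p 0) ^ 2 / (A : ℝ) - (p 1) ^ 2 / (B : ℝ)) / (C : ℝ)) ^ 3)) r.domain → r'.domain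 = {w | (w 0) ^ 2 + (w 1) ^ 2 < 1} → Set.EqOn r'.integrand (fun w => 1 / Real.sqrt (1 - (w 0) ^ 2 - (w 1) ^ 2)) r'.domain → Literature.NumberTheory.Transcendental.KZ.of r - Literature.NumberTheory.Transcendental.KZ.of r' ∈ Literature.NumberTheory.Transcendental.KZ.changeOfVariablesRel

-- `EllipsoidGaussMapCoV` holds: proved by `Summit.KontsevichZagierPeriods.CobordismMove.ellipsoidGaussMapCoV_proof` @ 02bcf0b9593c (its module imports this route file, so no `_holds` link can be stated here).

-- item stmt-KontsevichZagierPeriods-6791 · crux (kind.auto-crux: conjecture-grade) · rank 7 · open · by planner — informal only, no Lean statement yet: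
--   [crux] THE SIGNATURE / PONTRYAGIN SECTOR OF CONJECTURE 1 (card
--   cobordism-is-a-move-characteristic-numbers, sector theorem; needs notion NashChainRep and
--   CobordismInvariance stmt-6762). For every compact oriented ℚ-Nash submanifold M ⊂ ℝ^N of dimension
--   4k (ℚ-nonsingular ℚ-algebraic, or compact Nash), every oriented C¹-Nash fundamental cycle Z_M of M
--   (cubes/ordered simplices, Nash on open cells, covering M up to an H^{4k}-null set, positively
--   oriented), and every Pontryagin monomial I of weight k: NashChainRep(γ ∘ Z_M, P_I) − p_I[M] • A_I ∈
--   KZ.relations, where γ : M → Gr_{4k}(ℝ^N) ⊂ Sym_N(ℝ) is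

/-- item stmt-KontsevichZagierPeriods-17772 · support · rank 3 · closed · proved by Summit.KontsevichZagierPeriods.CobordismMove.CubeCoordinateCycle.cubeCoordinateCycle_proof @ 84b2c4392097 (prover) · by planner
[crux] CYCLING A COORDINATE TO THE LAST SLOT IS A MOVE, FOR AN ARBITRARY INTEGRAND ON THE OPEN UNIT
CUBE (piece P2 of the typed decomposition of CubeStokes). Data: d, k : Fin (d+1), reps R, R' on the
open cube (0,1)^(d+1) with R'.integrand z = R.integrand (Fin.insertNth k (z last) (Fin.init z)) on
the cube. Claim: of R − of R' ∈ KZ.relations. Plan: one changeOfVariablesRel instance (rule 2) from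
R' to R with Φ = the linear coordinate relabelling z ↦ (i ↦ z (e i)), e = (finSuccEquiv' k).trans
(finSuccEquiv' (Fin.last d)).symm (StrategistSplit.exists_perm_insertNth gives Φ z = insertNth k (z
last) (init z)), Φ' = Φ as a continuous linear map: Φ is a ℚ-polynomial map
(isSemialgebraicMapOn_aeval with X (e i)), injective, maps the open cube ONTO itself, and |det Φ'| =
1 (permutation matrix; or by volume preservation, Measure.addHaar_image_continuousLinearMap, exactly
as in KZ.of_sub_of_mem_relations_perm which is the integrand-1 case; KZCubeRational.rel_rename is
the rational-integrand case). Then negate (relations is a subgroup). [difficulty: M] (why it might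
fail: As typed only: the one-move claim needs R.domain = Φ '' R'.domain EXACTLY (the cube is
permutation-invariant — true) and | -/
@[route_item "route-KontsevichZagierPeriods-CobordismMove", crux]
def CubeCoordinateCycle : Prop :=
  ∀ (d : ℕ) (k : Fin (d + 1)) (R R' : Literature.NumberTheory.Transcendental.KZ.IntegralRep (d + 1)), R.domain = {x : Fin (d + 1) → ℝ | ∀ i, x i ∈ Set.Ioo (0 : ℝ) 1} → R'.domain = {x : Fin (d + 1) → ℝ | ∀ i, x i ∈ Set.Ioo (0 : ℝ) 1} → Set.EqOn R'.integrand (fun z => R.integrand (Fin.insertNth k (z (Fin.last d)) (Fin.init z))) R'.domain → Literature.NumberTheory.Transcendental.KZ.of R - Literature.NumberTheory.Transcendental.KZ.of R' ∈ Literature.NumberTheory.Transcendental.KZ.relations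

-- `CubeCoordinateCycle` holds: proved by `Summit.KontsevichZagierPeriods.CobordismMove.CubeCoordinateCycle.cubeCoordinateCycle_proof` @ 84b2c4392097 (its module imports this route file, so no `_holds` link can be stated here).

/-- item stmt-KontsevichZagierPeriods-19633 · support · rank 3 · open · by planner
[crux] MULTI-SHEET SIGNED PUSHFORWARD (piece X₁ of SignedSheetTransfer): for finitely many
ℚ-semialgebraic sheets σ_k ⊆ r.domain with co-null union, ℚ-semialgebraic maps Φ_k injective and
differentiable (HasFDerivWithinAt within σ_k) on σ_k, integer weights c_k, and image representations
ρ_k with ρ_k.domain = Φ_k σ_k: if r.integrand = Σ_k c_k·1_{σ_k}·(ρ_k.integrand∘Φ_k)·|det Φ'_k| on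
⋃σ_k then of r − Σ_k c_k • of ρ_k ∈ KZ.relations. No multiplicity / count hypothesis: every sheet is
pushed forward separately by ONE instance of rule (2). Proof (strategist file
Cruxes/SignedSheetTransfer/SignedSheetTransferProof.lean, sorry-free): shrink sheets to open V_k =
interior σ_k ∖ ⋃_j ∂σ_j (frontiers of semialgebraic sets are null), where Φ'_k is the Fréchet
derivative and |det Φ'_k| is ℚ-semialgebraic (partials by one-variable Tarski–Seidenberg, Leibniz);
push each zero-extended sheet term by changeOfVariablesRel; images of the null differences are null
(Mathlib addHaar_image_eq_zero_of_differentiableOn_of_addHaar_eq_zero); collect by ZeroCombination.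
Why it might fail: Only through the typing: |det Φ'_k| must be ℚ-semialgebraic for the peeled sheet
terms to be IntegralReps — false for arbi -/
@[route_item "route-KontsevichZagierPeriods-CobordismMove"]
def SignedSheetPushforward : Prop :=
  ∀ (n N : ℕ) (r : Literature.NumberTheory.Transcendental.KZ.IntegralRep n) (c : Fin N → ℤ) (σ : Fin N → Set (Fin n → ℝ)) (Φ : Fin N → (Fin n → ℝ) → (Fin n → ℝ)) (Φ' : Fin N → (Fin n → ℝ) → ((Fin n → ℝ) →L[ℝ] (Fin n → ℝ))) (ρ : Fin N → Literature.NumberTheory.Transcendental.KZ.IntegralRep n), (∀ k, Literature.ModelTheory.ExponentialFields.IsSemialgebraic ℚ (σ k)) → (∀ k, σ k ⊆ r.domain) → MeasureTheory.volume (r.domain \ ⋃ k, σ k) = 0 → (∀ k, Literature.NumberTheory.Transcendental.IsSemialgebraicMapOn ℚ (σ k) (Φ k)) → (∀ k, ∀ x ∈ σ k, HasFDerivWithinAt (Φ k) (Φ' k x) (σ k) x) → (∀ k, Set.InjOn (Φ k) (σ k)) → (∀ k, (ρ k).domain = Φ k '' σ k) → (∀ x ∈ ⋃ k, σ k, r.integrand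 x = ∑ k : Fin N, (c k : ℝ) * (σ k).indicator (fun y => (ρ k).integrand (Φ k y) * |(Φ' k y).det|) x) → Literature.NumberTheory.Transcendental.KZ.of r - ∑ k : Fin N, c k • Literature.NumberTheory.Transcendental.KZ.of (ρ k) ∈ Literature.NumberTheory.Transcendental.KZ.relations

/-- item stmt-KontsevichZagierPeriods-19639 · support · rank 4 · open · by planner
[crux] CONSTANT SIGNED COUNT REGROUPS (piece X₂ of SignedSheetTransfer): for sub-representations ρ_k
of r' (ρ_k.domain ⊆ r'.domain, same integrand there) and integer weights c_k with Σ_k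
c_k·1_{ρ_k.domain} = D a.e. on r'.domain: Σ_k c_k • of ρ_k − D • of r' ∈ KZ.relations. Proof
(strategist file, sorry-free): on the equaliser E = {y ∈ r'.domain | Σ c_k 1_{ρ_k.domain}(y) = D}
(ℚ-semialgebraic by graph elimination KZ.isSemialgebraic_sep_eq, co-null by hypothesis) the
zero-extended representations [r'.domain, 1_{ρ_k.domain}·g] and −D•[r'] form a zero combination
(ZeroCombination.zeroCombination_holds); [r'.domain, 1_{ρ_k.domain} g] − [ρ_k] ∈ relations by domain
additivity with a zero piece. Why it might fail: Only if the a.e.-count hypothesis could not be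
converted into a semialgebraic co-null equaliser set (it can: the count function is ℚ-semialgebraic
as a finite ℤ-combination of indicators of semialgebraic sets); no obstruction remains — proved in
the strategist file. Sources: KontsevichZagier2001, BCR1998, HuberMullerStach2017. [strategist
BC2-redirect piece of SignedSheetTransfer stmt-KontsevichZagierPeriods-5567; assembly
signedSheetTransfer_of_subs proved in Cruxes/SignedSheetT -/
@[route_item "route-KontsevichZagierPeriods-CobordismMove"]
def SignedCountRegroup : Prop :=
  ∀ (n N : ℕ) (D : ℤ) (r' : Literature.NumberTheory.Transcendental.KZ.IntegralRep n) (c : Fin N → ℤ) (ρ : Fin N → Literature.NumberTheory.Transcendental.KZ.IntegralRep n), (∀ k, (ρ k).domain ⊆ r'.domain) → (∀ k, Set.EqOn (ρ k).integrand r'.integrand (ρ k).domain) → (∀ᵐ y ∂(MeasureTheory.volume.restrict r'.domain), (∑ k : Fin N, (c k : ℝ) * ((ρ k).domain).indicator (fun _ => (1 : ℝ)) y) = (D : ℝ)) → (∑ k : Fin N, c k • Literature.NumberTheory.Transcendental.KZ.of (ρ k)) - D • Literature.NumberTheory.Transcendental.KZ.of r' ∈ Literature.NumberTheory.Transcenden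tal.KZ.relations

-- item stmt-KontsevichZagierPeriods-6762 · support · rank 6 · open · by planner — informal only, no Lean statement yet:
--   [crux] COBORDANT (HOMOLOGOUS) NASH CYCLES GIVE KZ-EQUIVALENT REPRESENTATIONS — the cobordism move
--   proper (card cobordism-is-a-move-characteristic-numbers, refuter's Grassmannian sharpening); the
--   decisive item of the line, to be re-ranked 2 once typed. Setting (needs notion NashChainRep,
--   definition request filed): V ⊂ ℝ^N a compact ℚ-nonsingular ℚ-algebraic set (e.g. the projector model
--   of the Grassmannian Gr_d(ℝ^N) ⊂ Sym_N(ℝ)); ω a d-form on ℝ^N with ℚ-polynomial coefficients, CLOSED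
--   on V (dω|_V = 0; e.g. the O(N)-invariant Pontryagin forms P_I(Ω_taut), Ω_taut = P dP∧dP P); Z = Σ
--   n_j c_j a C¹

/-- item stmt-KontsevichZagierPeriods-14317 · support · rank 9 · closed · proved by Summit.KontsevichZagierPeriods.CobordismMove.KernelFormGlue.KernelFormGlue_proof @ 18f42850584c (prover) · by planner
sources: KontsevichZagier2001, HuberMullerStach2017
[support] GLUE TO THE RANK-0 TARGET, provable now (planner Sketch.lean rc 0: `intro hKF c hc; exact
AddSubgroup.closure_mono (Set.subset_union_left.trans Set.subset_union_left) (hKF c hc)`). The plain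
kernel form of Conjecture 1 — every formal ℤ-combination of integral representations with value 0
lies in KZ.relations; INLINED, never the Literature constant KZKernelConjecture (open, ≡ summit by
kzKernelConjecture_iff_isRational / KernelFormKernelImpliesStatement; cf.
IsogenyCertificates.KernelFormGlue, Grothendieck rev 7), so no open-conjecture constant enters the
cone — implies TopologicalMovesKernel by monotonicity of AddSubgroup.closure (relations =
closure(moves) ≤ closure(moves ∪ cube-Stokes relators ∪ signed-sheet relators)). Conversely
CubeStokes → SignedSheetTransfer → TopologicalMovesKernel → kernel form is the deciding theorem
`closes` read in kernel form (second example in Sketch.lean). The item records the thesis' honesty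
clause formally — TopologicalMovesKernel is sandwiched between the kernel form and the kernel form
given the two engines, GPC-strength exactly there — and gives the target an item that concludes it
(gate shape route.target-unreachable; route-choice 202 -/
@[route_item "route-KontsevichZagierPeriods-CobordismMove"]
def KernelFormGlue : Prop :=
  (∀ c : Literature.NumberTheory.Transcendental.KZ.FormalRep, Literature.NumberTheory.Transcendental.KZ.eval c = 0 → c ∈ Literature.NumberTheory.Transcendental.KZ.relations) → TopologicalMovesKernel

-- `KernelFormGlue` holds: proved by `Summit.KontsevichZagierPeriods.CobordismMove.KernelFormGlue.KernelFormGlue_proof` @ 18f42850584c (its module imports this route file, so no `_holds` link can be stated here).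

/-- item stmt-KontsevichZagierPeriods-17773 · support · rank 9 · closed · proved by Summit.KontsevichZagierPeriods.CobordismMove.ZeroCombination.zeroCombination_proof @ 6e18418410be (prover) · by planner
[support] A ℤ-COMBINATION OF REPRESENTATIONS ON A COMMON DOMAIN WHOSE INTEGRANDS COMBINE TO ZERO
POINTWISE IS A RELATION (piece P3 of the typed decomposition of CubeStokes; where the closedness
Σ(−1)^k ∂_k A_k = 0 is consumed). Data: reps R i (i < N) with (R i).domain = σ and Σ_i (c i) (R
i).integrand x = 0 for x ∈ σ, c i ∈ ℤ. Claim: Σ_i c i • of (R i) ∈ KZ.relations. Plan (provable now,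
iterated rule 1b): S_i = [σ, (c i)·f_i] exists (mul_holds with a rational constant); of S_i − (c i)
• of (R i) ∈ relations by induction on |c i| (integrandAddRel, of_add_of_mem_relations_of_eqOn_neg);
of [σ, Σ c_i f_i] − Σ of S_i ∈ relations (KZ.of_sub_sum_integrand_mem_relations); [σ, Σ c_i f_i] has
integrand 0 on σ, so it is a relation (KZ.of_mem_relations_of_eqOn_zero). N = 0 is the empty sum.
[difficulty: S] [KontsevichZagier2001] -/
@[route_item "route-KontsevichZagierPeriods-CobordismMove", crux]
def ZeroCombination : Prop :=
  ∀ (n N : ℕ) (σ : Set (Fin n → ℝ)) (R : Fin N → Literature.NumberTheory.Transcendental.KZ.IntegralRep n) (c : Fin N → ℤ), (∀ i, (R i).domain = σ) → (∀ x ∈ σ, ∑ i, (c i : ℝ) * (R i).integrand x = 0) → (∑ i, c i • Literature.NumberTheory.Transcendental.KZ.of (R i)) ∈ Literature.NumberTheory.Transcendental.KZ.relations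

-- `ZeroCombination` holds: proved by `Summit.KontsevichZagierPeriods.CobordismMove.ZeroCombination.zeroCombination_proof` @ 6e18418410be (its module imports this route file, so no `_holds` link can be stated here).

/-- item stmt-KontsevichZagierPeriods-3169 · support · rank 9 · closed · proved by Summit.KontsevichZagierPeriods.CoactionDevissage.TorsionFree.exceptionalCouplings_torsionFree_proof @ f648441f8c8f (prover) · by planner
sources: KontsevichZagier2001, Thom1954, MilnorStasheff1974
[support] P_KZ is torsion-free: n ≠ 0, n • c ∈ KZ.relations ⇒ c ∈ KZ.relations. Proof: c − c·[0,1] ∈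
relations (Newton–Leibniz on each generator r with base r, band r.domain × [0,1] = (r.prod
I₀₁).domain, F(x,t) = t·f(x)); c·[0,1] − n • (c·[0,1/n]) ∈ relations (domain additivity into n slabs
over the null overlaps r.domain × {k/n}, translations t ↦ t − k/n as changes of variables); n •
(c·[0,1/n]) = (n • c)·[0,1/n] ∈ relations by `KZ.mul_mem_relations_right_holds`. Card item D0.
[difficulty: provable-now] -/
@[route_item "route-KontsevichZagierPeriods-CobordismMove"]
def TorsionFree : Prop :=
  ∀ (n : ℕ) (c : Literature.NumberTheory.Transcendental.KZ.FormalRep), n ≠ 0 → n • c ∈ Literature.NumberTheory.Transcendental.KZ.relations → c ∈ Literature.NumberTheory.Transcendental.KZ.relations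

-- `TorsionFree` holds: proved by `Summit.KontsevichZagierPeriods.CoactionDevissage.TorsionFree.exceptionalCouplings_torsionFree_proof` @ f648441f8c8f (its module imports this route file, so no `_holds` link can be stated here).

/-- item stmt-KontsevichZagierPeriods-5570 · support · rank 9 · closed · proved by Summit.KontsevichZagierPeriods.CobordismMove.CP2Volume.cp2Volume_proof @ 8312c53c83b5 (prover) · by planner
sources: KontsevichZagier2001, MilnorStasheff1974
[support] ANCHOR vol(ℂP²) = π²/2 as a chain with KZ-literal (rational) data: 2·[ℝ⁴, 1/(1+|x|²)³] −
[ℝ², 1/((1+x₀²)(1+x₁²))] ∈ KZ.relations (ω_FS² on the affine chart is (2/π²)·dV/(1+|z|²)³; values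
2·π²/2 and π²). Plan: polar/torus changes of variables (x₀,x₁,x₂,x₃) ↦ (s = x₀²+x₁², t = x₂²+x₃²,
two angles) on the complement of a null set, tan-half-angle for the angles, Newton–Leibniz in s and
t with rational primitives; this is the U(1)²-action instance of card bending-flows-dh-is-a-move
(credited). It is the anchor every SignatureSector chain ends in. [difficulty: M] -/
@[route_item "route-KontsevichZagierPeriods-CobordismMove"]
def CP2Volume : Prop :=
  ∀ (r : Literature.NumberTheory.Transcendental.KZ.IntegralRep 4) (r' : Literature.NumberTheory.Transcendental.KZ.IntegralRep 2), r.domain = Set.univ → Set.EqOn r.integrand (fun x => 1 / (1 + ∑ i, (x i) ^ 2) ^ 3) r.domain → r'.domain = Set.univ → Set.EqOn r'.integrand (fun y => 1 / ((1 + (y 0) ^ 2) * (1 + (y 1) ^ 2))) r'.domain → 2 • Literature.NumberTheory.Transcendental.KZ.of r - Literature.NumberTheory.Transcendental.KZ.of r' ∈ Literature.NumberTheory.Transcendental.KZ.relations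

-- `CP2Volume` holds: proved by `Summit.KontsevichZagierPeriods.CobordismMove.CP2Volume.cp2Volume_proof` @ 8312c53c83b5 (its module imports this route file, so no `_holds` link can be stated here).

/-- item stmt-KontsevichZagierPeriods-5571 · assembly · rank 1 · closed · proved by Summit.KontsevichZagierPeriods.CobordismMove.assembly_proof @ 9d84f6732926 (prover) · by planner
sources: KontsevichZagier2001, HuberMullerStach2017
[assembly] CubeStokes → SignedSheetTransfer → TopologicalMovesKernel → KontsevichZagierPeriods. -/
@[route_item "route-KontsevichZagierPeriods-CobordismMove"]
def Assembly : Prop :=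
  CubeStokes → SignedSheetTransfer → TopologicalMovesKernel → KontsevichZagierPeriods

-- `Assembly` holds: proved by `Summit.KontsevichZagierPeriods.CobordismMove.assembly_proof` @ 9d84f6732926 (its module imports this route file, so no `_holds` link can be stated here).

/-! D-0027 §2.1 — DECIDING THEOREM (planner-authored via `route open/edit --closes-file`; by planner-rbadge-KontsevichZagierPeriods-Cobordi-d891400b-g2-0 2026-08-15T16:10:36Z):
its hypotheses are this route's items and its conclusion the sub-problem Statement (glue_lint), and it elaborates with this file. -/

@[closes "route-KontsevichZagierPeriods-CobordismMove"] theorem closes (h₁ : CubeStokes) (h₂ : SignedSheetTransfer) (h₃ : TopologicalMovesKernel) : KontsevichZagierPeriods := by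
  intro n m r r' _ _ hv
  have h0 : Literature.NumberTheory.Transcendental.KZ.eval
      (Literature.NumberTheory.Transcendental.KZ.of r - Literature.NumberTheory.Transcendental.KZ.of r') = 0 := by
    simp [Literature.NumberTheory.Transcendental.KZ.eval_of, hv]
  have hmem := h₃ _ h0
  have hle : ∀ (S : Set Literature.NumberTheory.Transcendental.KZ.FormalRep),
      S ⊆ (Literature.NumberTheory.Transcendental.KZ.relations : Set Literature.NumberTheory.Transcendental.KZ.FormalRep) →
      ∀ x, x ∈ AddSubgroup.closure S → x ∈ Literature.NumberTheory.Transcendental.KZ.relations :=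
    fun S hS x hx => (AddSubgroup.closure_le _).mpr hS hx
  refine hle _ ?_ _ hmem
  rintro e (((((he | he) | he) | he) | he) | he)
  · exact Literature.NumberTheory.Transcendental.KZ.domainAddRel_subset_relations he
  · exact Literature.NumberTheory.Transcendental.KZ.integrandAddRel_subset_relations he
  · exact Literature.NumberTheory.Transcendental.KZ.changeOfVariablesRel_subset_relations he
  · exact Literature.NumberTheory.Transcendental.KZ.newtonLeibnizRel_subset_relations he
  · obtain ⟨d, A, A', rf, hA, hA', hcont, hder, hint, hclosed, hdom, hface, rfl⟩ := he
    exact h₁ d A A' rf hA hA' hcont hder hint hclosed hdom hface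
  · obtain ⟨k, N, D, ρ, ρ', ε, σ, Φ, Φ', hε, hσ, hsub, hnull, hmap, hder, hinj, himg, hcount, hintg, rfl⟩ := he
    exact h₂ k N D ρ ρ' ε σ Φ Φ' hε hσ hsub hnull hmap hder hinj himg hcount hintg

end Summit.KontsevichZagierPeriods.KontsevichZagierPeriods.Theses.CobordismMove
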